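import Mathlib
import Summits.NavierStokesRegularity.NavierStokesRegularity.Theorems.FilamentSkeletonRssClause13ModelPieceBandPrelim
import Summits.NavierStokesRegularity.NavierStokesRegularity.Theorems.FilamentSkeletonRssClause13ModelLowDirichlet
import Summits.NavierStokesRegularity.NavierStokesRegularity.Theorems.FilamentSkeletonRssClause13LowSliceBottom

/-!
# Clause 13-J/13-R, brick n3 LAYER C (LOWEST-FREQUENCY PIECE S0): for `P = k∗Y` with profile in `|z|√q ≤ a ≤ 1/10`,
# `‖P‖₂² ≤ (θ/(π√q))‖k‖₁²‖Y‖₁² + (q/θ²)·[(2/g)(A + B) + (Λ²/g²)·2(‖k‖₁‖(τ−c)Y‖₂ + ‖t k‖₁‖Y‖₂)²]`, `g = G·½log(1/a)`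

Route `FilamentSkeletonRss`, ∃-side clause 13 (`Clause13RNearStraightL` stmt-NavierStokesRegularity-23612; typing-agnostic); design
`filament-plan/DESIGN-28296-model-gluing-g16-v2-addendum.md` §A (piece S0; task C-S0).  Inputs: the low-regime Dirichlet estimate
`model_lowRegime_dirichlet_estimate` (p696818: `g·‖P′‖² ≤ ‖𝓛P‖‖P‖ + Λ‖P′‖‖(τ−c)P‖ + (b₁+b₂)‖P‖²`), the bottom estimate `setIntegral_bottom_normSq_le`
(p695802), Plancherel and `∫‖f′‖² = (1/2π)∫z²|f̂|²` (p696818), and the real-kernel piece lemmas (p699582, p700907, p701338, p701838).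
* §1 `integral_norm_piece_le` (`‖k∗Y‖₁ ≤ ‖k‖₁‖Y‖₁`), `normSq_le_bottom_add_dirichlet` (`‖f‖₂² ≤ (θ/(π√q))‖f‖₁² + (q/θ²)‖f′‖₂²`, any `θ > 0`);
* §2 `model_piece_low_estimate`: Young's inequality `Λ‖P′‖X ≤ (g/2)‖P′‖² + Λ²X²/(2g)` absorbs the transport into the Dirichlet gain, whence
  `‖P′‖² ≤ (2/g)(A+B) + Λ²X²/g²` with `A = ‖𝓛P‖‖P‖ ≤ (‖k‖₁N(𝓛Y) + C_kN(Y))·‖k‖₁N(Y)`, `B = (b₁+b₂)‖P‖² ≤ (b₁+b₂)‖k‖₁²‖Y‖²`,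
  `X = ‖(τ−c)P‖ ≤ √2(‖k‖₁N((τ−c)Y) + ‖t k‖₁N(Y))`, and the bottom estimate finishes.  (In the gluing `a = x_s ~ Γ^{-1/4}`, `θ = θ₀√q/R`.)
Lane ns-filament-19175-p1 g16; `--supports stmt-NavierStokesRegularity-23612 --as helper`.
HONEST FRAMING: bookkeeping about an explicit 1-D model operator attached to a HYPOTHETICAL filament skeleton on the NEGATIVE side of a MODEL route;
nothing here bears on Navier–Stokes regularity or blow-up.
-/

noncomputable section

open MeasureTheory Real Complex Filter Set
open scoped ComplexConjugate Topology Convolution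
open Summit.NavierStokesRegularity.NavierStokesRegularity.Theorems.AnalyticStripLiaSymbol (liaSym)

namespace Summit.NavierStokesRegularity.NavierStokesRegularity.Theorems.MatchedKernel
set_option linter.dupNamespace false

/-! ## §1 `L¹` bound of a piece; bottom + Dirichlet control of `‖f‖₂²` -/

/-- **`‖k∗Y‖₁ ≤ ‖k‖₁‖Y‖₁`** (Young `L¹ × L¹`). [folklore] -/
theorem integral_norm_piece_le {k : ℝ → ℝ} (hkc : Continuous k) (hki : Integrable k) {Y : ℝ → ℂ} (hYc : Continuous Y)
    (hYs : HasCompactSupport Y) :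
    ∫ x : ℝ, ‖∫ y : ℝ, ((k (x - y) : ℝ) : ℂ) * Y y‖ ≤ (∫ t, |k t|) * ∫ y : ℝ, ‖Y y‖ := by
  have hYi : Integrable Y := hYc.integrable_of_hasCompactSupport hYs
  have hY1 : Integrable fun y : ℝ => ‖Y y‖ := hYi.norm
  have hconv : (fun x : ℝ => ∫ y : ℝ, |k (x - y)| * ‖Y y‖)
      = (fun t : ℝ => |k t|) ⋆[ContinuousLinearMap.lsmul ℝ ℝ, volume] (fun y : ℝ => ‖Y y‖) := by
    funext x; exact (convolution_lsmul_eq_integral_sub (fun t => |k t|) (fun y => ‖Y y‖) x).symm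
  have hci : Integrable fun x : ℝ => ∫ y : ℝ, |k (x - y)| * ‖Y y‖ := by
    rw [hconv]; exact hki.abs.integrable_convolution _ hY1
  calc ∫ x : ℝ, ‖∫ y : ℝ, ((k (x - y) : ℝ) : ℂ) * Y y‖ ≤ ∫ x : ℝ, ∫ y : ℝ, |k (x - y)| * ‖Y y‖ :=
        integral_mono_of_nonneg (ae_of_all _ fun x => norm_nonneg _) hci (ae_of_all _ fun x => norm_piece_le hkc hYc hYs x)
    _ = (∫ t, |k t|) * ∫ y : ℝ, ‖Y y‖ := by
        rw [hconv, integral_convolution (L := ContinuousLinearMap.lsmul ℝ ℝ) hki.abs hY1]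
        simp only [ContinuousLinearMap.lsmul_apply, smul_eq_mul]

/-- **Bottom + Dirichlet**: for `f ∈ C¹` with `f, f′ ∈ L¹ ∩ L²`, `q, θ > 0`:
`∫‖f‖² ≤ (θ/(π√q))·(∫‖f‖)² + (q/θ²)·∫‖f′‖²` (Plancherel; `|f̂| ≤ ‖f‖₁` on `|z|√q < θ`, `1 ≤ qz²/θ²` off it). [folklore] -/
theorem normSq_le_bottom_add_dirichlet {q θ : ℝ} (hq : 0 < q) (hθ : 0 < θ) {f f' : ℝ → ℂ} (hf : ∀ x, HasDerivAt f (f' x) x)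
    (hfi : Integrable f) (hf2 : MemLp f 2) (hf'i : Integrable f') (hf'2 : MemLp f' 2) :
    ∫ x : ℝ, ‖f x‖ ^ 2 ≤ θ / (π * √q) * (∫ x : ℝ, ‖f x‖) ^ 2 + q / θ ^ 2 * ∫ x : ℝ, ‖f' x‖ ^ 2 := by
  have hsq : 0 < √q := Real.sqrt_pos.2 hq
  have hπ : 0 < π := Real.pi_pos
  set F : ℝ → ℝ := fun z => ‖∫ x : ℝ, f x * cexp (I * z * x)‖ ^ 2 with hF
  have hFi : Integrable F := integrable_norm_sq_unnormalisedTransform hfi hf2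
  have hF0 : ∀ z, 0 ≤ F z := fun z => by positivity
  -- Plancherel
  have hpl : ∫ x : ℝ, ‖f x‖ ^ 2 = 1 / (2 * π) * ∫ z, F z := by
    rw [← Literature.Analysis.FunctionSpaces.integral_norm_sq_fourierIntegral_eq hfi hf2, integral_norm_sq_fourier_eq_unnormalised]
  -- `z²F = |transform of f′|²`
  have hz2 : ∀ z : ℝ, z ^ 2 * F z = ‖∫ x : ℝ, f' x * cexp (I * z * x)‖ ^ 2 := by
    intro z
    simp only [hF]
    rw [unnormalisedTransform_deriv hf hfi hf'i z, norm_mul, norm_neg, norm_mul, Complex.norm_I, Complex.norm_real, one_mul,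
      Real.norm_eq_abs, mul_pow, sq_abs]
  have hz2i : Integrable fun z : ℝ => z ^ 2 * F z :=
    (integrable_norm_sq_unnormalisedTransform hf'i hf'2).congr (ae_of_all _ fun z => (hz2 z).symm)
  have hdir : ∫ z : ℝ, z ^ 2 * F z = 2 * π * ∫ x : ℝ, ‖f' x‖ ^ 2 := by
    rw [integral_norm_sq_deriv_eq_spectral hf hfi hf'i hf'2, ← mul_assoc, mul_one_div_cancel (by positivity : (2 : ℝ) * π ≠ 0),
      one_mul]
  -- split at `|z|√q = θ`
  set S : Set ℝ := {z : ℝ | |z| * √q < θ} with hS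
  have hSm : MeasurableSet S := by
    have e : S = Set.Ioo (-(θ / √q)) (θ / √q) := by
      ext z; rw [hS, Set.mem_setOf_eq, Set.mem_Ioo, ← lt_div_iff₀ hsq, abs_lt]
    rw [e]; exact measurableSet_Ioo
  have hsplit : ∫ z, F z = (∫ z in S, F z) + ∫ z in Sᶜ, F z := (integral_add_compl hSm hFi).symm
  have hbot : ∫ z in S, F z ≤ 2 * θ / √q * (∫ x : ℝ, ‖f x‖) ^ 2 := setIntegral_bottom_normSq_le hq hθ f
  have htop : ∫ z in Sᶜ, F z ≤ q / θ ^ 2 * ∫ z : ℝ, z ^ 2 * F z := by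
    have hθ2 : 0 < θ ^ 2 := by positivity
    calc ∫ z in Sᶜ, F z ≤ ∫ z in Sᶜ, q / θ ^ 2 * (z ^ 2 * F z) := by
          refine setIntegral_mono_on hFi.integrableOn (hz2i.const_mul _).integrableOn hSm.compl fun z hz => ?_
          have hz' : θ ≤ |z| * √q := not_lt.1 hz
          have h1 : θ ^ 2 ≤ q * z ^ 2 := by
            have h := mul_self_le_mul_self hθ.le hz'
            have e : |z| * √q * (|z| * √q) = q * z ^ 2 := by
              rw [show |z| * √q * (|z| * √q) = (√q * √q) * (|z| * |z|) by ring, Real.mul_self_sqrt hq.le, ← sq, sq_abs]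
            rw [← sq, e] at h
            exact h
          have h2 : 1 ≤ q / θ ^ 2 * z ^ 2 := by
            rw [div_mul_eq_mul_div, le_div_iff₀ hθ2, one_mul]; exact h1
          calc F z = 1 * F z := (one_mul _).symm
            _ ≤ q / θ ^ 2 * z ^ 2 * F z := mul_le_mul_of_nonneg_right h2 (hF0 z)
            _ = q / θ ^ 2 * (z ^ 2 * F z) := by ring
      _ ≤ ∫ z : ℝ, q / θ ^ 2 * (z ^ 2 * F z) :=
          setIntegral_le_integral (hz2i.const_mul _) (ae_of_all _ fun z => by positivity)
      _ = q / θ ^ 2 * ∫ z : ℝ, z ^ 2 * F z := integral_const_mul _ _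
  rw [hpl, hsplit]
  have hsum := add_le_add hbot (htop.trans (le_of_eq (by rw [hdir])))
  refine (mul_le_mul_of_nonneg_left hsum (by positivity)).trans (le_of_eq ?_)
  field_simp

/-! ## §2 The S0 piece estimate -/

/-- **S0 PIECE ESTIMATE.**  `q, G > 0`, `0 < a ≤ 1/10`, `θ > 0`; `k` real `C¹`, bounded, `k, k′, t k, t k′ ∈ L¹`, profile `χ(z) = ∫k e^{izt}`
supported in `|z|√q ≤ a`; `Y ∈ C¹_c`; `w` differentiable, `w(c) = 0`, `|w′| ≤ Λ`; `β_i` continuous, `‖β_i‖ ≤ b_i`, `‖β_i(y)−β_i(x)‖ ≤ L_i|y−x|`.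
With `P = k∗Y`, `g = G·½log(1/a)`, `C_k = Λ(‖t k′‖₁+‖k‖₁) + (L₁+L₂)‖t k‖₁`, `N(f) = (∫‖f‖²)^{1/2}`:
`∫‖P‖² ≤ (θ/(π√q))·(‖k‖₁∫‖Y‖)² + (q/θ²)·[(2/g)·((‖k‖₁N(𝓛Y) + C_kN(Y))·‖k‖₁N(Y) + (b₁+b₂)‖k‖₁²∫‖Y‖²) + (Λ²/g²)·2(‖k‖₁N((τ−c)Y) + ‖t k‖₁N(Y))²]`.
[folklore] -/
theorem model_piece_low_estimate {q G a θ : ℝ} (hq : 0 < q) (hG : 0 < G) (ha : 0 < a) (ha' : a ≤ 1 / 10) (hθ : 0 < θ)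
    {k k' : ℝ → ℝ} (hk : ∀ t, HasDerivAt k (k' t) t) (hk'c : Continuous k') (hki : Integrable k) (hk'i : Integrable k')
    (hk1 : Integrable fun t => t * k t) (hk'1 : Integrable fun t => t * k' t) {Mk : ℝ} (hkM : ∀ t, |k t| ≤ Mk)
    {χ : ℝ → ℂ} (hkχ : ∀ z : ℝ, ∫ t : ℝ, ((k t : ℝ) : ℂ) * cexp (I * z * t) = χ z)
    (hlow : ∀ z : ℝ, χ z ≠ 0 → |z| * √q ≤ a)
    {Y : ℝ → ℂ} (hY : ContDiff ℝ 1 Y) (hYs : HasCompactSupport Y) (c : ℝ)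
    {w : ℝ → ℝ} (hw : Differentiable ℝ w) {Λ : ℝ} (hΛ : ∀ t, |deriv w t| ≤ Λ) (hwc : w c = 0)
    {β₁ β₂ : ℝ → ℂ} (hβ₁c : Continuous β₁) (hβ₂c : Continuous β₂) {b₁ b₂ L₁ L₂ : ℝ}
    (hb₁ : ∀ τ, ‖β₁ τ‖ ≤ b₁) (hb₂ : ∀ τ, ‖β₂ τ‖ ≤ b₂) (hL₁ : ∀ x y, ‖β₁ y - β₁ x‖ ≤ L₁ * |y - x|)
    (hL₂ : ∀ x y, ‖β₂ y - β₂ x‖ ≤ L₂ * |y - x|) :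
    ∫ x : ℝ, ‖∫ y : ℝ, ((k (x - y) : ℝ) : ℂ) * Y y‖ ^ 2
      ≤ θ / (π * √q) * ((∫ t, |k t|) * ∫ y : ℝ, ‖Y y‖) ^ 2
        + q / θ ^ 2 * (2 / (G * (1 / 2 * Real.log (1 / a))) * ((((∫ t, |k t|) * (∫ y : ℝ, ‖I * (G : ℂ) * ((2 / q : ℂ) * Y y
              - ∫ σ : ℝ, ((((2 * q - (y - σ) ^ 2) * (((y - σ) ^ 2 + q) ^ (5 / 2 : ℝ))⁻¹ : ℝ)) : ℂ) * Y σ)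
            - ((w y : ℝ) : ℂ) * deriv Y y + β₁ y * Y y + β₂ y * conj (Y y)‖ ^ 2) ^ (1 / 2 : ℝ)
            + (Λ * ((∫ t, |t| * |k' t|) + (∫ t, |k t|)) + (L₁ + L₂) * (∫ t, |t| * |k t|)) * (∫ y : ℝ, ‖Y y‖ ^ 2) ^ (1 / 2 : ℝ)) * ((∫ t, |k t|) * (∫ y : ℝ, ‖Y y‖ ^ 2) ^ (1 / 2 : ℝ)))
            + ((b₁ + b₂) * ((∫ t, |k t|) ^ 2 * ∫ y : ℝ, ‖Y y‖ ^ 2)))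
          + Λ ^ 2 / (G * (1 / 2 * Real.log (1 / a))) ^ 2 * (2 * ((∫ t, |k t|) * (∫ y : ℝ, ‖(((y - c : ℝ) : ℂ)) * Y y‖ ^ 2) ^ (1 / 2 : ℝ) + (∫ t, |t| * |k t|) * (∫ y : ℝ, ‖Y y‖ ^ 2) ^ (1 / 2 : ℝ)) ^ 2)) := by
  have hkc : Continuous k := continuous_iff_continuousAt.2 fun t => (hk t).continuousAt
  have hYc := hY.continuous
  have hY'c : Continuous (deriv Y) := hY.continuous_deriv le_rfl
  have hYi : Integrable Y := hYc.integrable_of_hasCompactSupport hYs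
  have hΛ0 : 0 ≤ Λ := (abs_nonneg _).trans (hΛ 0)
  have hb0 : 0 ≤ b₁ + b₂ := add_nonneg ((norm_nonneg _).trans (hb₁ 0)) ((norm_nonneg _).trans (hb₂ 0))
  have hlog : 0 < Real.log (1 / a) := Real.log_pos (by rw [lt_div_iff₀ ha]; linarith)
  have hg : 0 < (G * (1 / 2 * Real.log (1 / a))) := by positivity
  -- Layer B facts for the piece
  have hPd : ∀ x : ℝ, HasDerivAt (fun x : ℝ => ∫ y : ℝ, ((k (x - y) : ℝ) : ℂ) * Y y) (∫ y : ℝ, ((k (x - y) : ℝ) : ℂ) * deriv Y y) x := hasDerivAt_piece hkc hY hYs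
  have hP1 : Integrable fun x : ℝ => ∫ y : ℝ, ((k (x - y) : ℝ) : ℂ) * Y y := integrable_piece hki hYc hYs
  have hP2 : MemLp (fun x : ℝ => ∫ y : ℝ, ((k (x - y) : ℝ) : ℂ) * Y y) 2 volume := memLp_piece hkc hki hYc hYs
  have hP'1 : Integrable fun x : ℝ => ∫ y : ℝ, ((k (x - y) : ℝ) : ℂ) * deriv Y y := integrable_piece hki hY'c hYs.deriv
  have hP'2 : MemLp (fun x : ℝ => ∫ y : ℝ, ((k (x - y) : ℝ) : ℂ) * deriv Y y) 2 volume := memLp_piece hkc hki hY'c hYs.deriv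
  have hwP2 := memLp_weight_piece hkc hki hk1 hYc hYs c
  obtain ⟨hwP'2, _⟩ := l2_weight_pieceDeriv_le hk hk'c hk'i hk'1 hY hYs c
  have hM2 := memLp_modelSelf_piece hq hkc hki hkM hYc hYs
  have hsuppP : ∀ z : ℝ, a < |z| * √q → ∫ x : ℝ, (∫ y : ℝ, ((k (x - y) : ℝ) : ℂ) * Y y) * cexp (I * z * x) = 0 := by
    intro z hz
    by_contra hne
    have h := hlow z (transform_piece_ne_zero hki hkχ hYi z hne)
    linarith
  -- the Dirichlet estimate and the bottom estimate for `P`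
  have hdir := model_lowRegime_dirichlet_estimate hq hG ha ha' hPd hP1 hP2 hP'1 hP'2 c hwP2 hwP'2 hM2 hsuppP hw hΛ hwc
    hβ₁c.aestronglyMeasurable hβ₂c.aestronglyMeasurable hb₁ hb₂
  have hbot := normSq_le_bottom_add_dirichlet hq hθ hPd hP1 hP2 hP'1 hP'2
  -- the factor bounds
  have hL := l2_pieceOperator_le (G := G) hq hk hk'c hki hk1 hk'1 hkM hY hYs hw hΛ hβ₁c hβ₂c hb₁ hb₂ hL₁ hL₂
  obtain ⟨_, hPle⟩ := integral_sq_norm_piece_le hkc hki hYc hYs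
  have hk0 : 0 ≤ ∫ t, |k t| := integral_nonneg fun t => abs_nonneg _
  have hk10 : 0 ≤ ∫ t, |t| * |k t| := integral_nonneg fun t => by positivity
  have hk'10 : 0 ≤ ∫ t, |t| * |k' t| := integral_nonneg fun t => by positivity
  have hL10 : 0 ≤ L₁ := by
    have := hL₁ 0 1; rw [sub_zero, abs_one, mul_one] at this; exact (norm_nonneg _).trans this
  have hL20 : 0 ≤ L₂ := by
    have := hL₂ 0 1; rw [sub_zero, abs_one, mul_one] at this; exact (norm_nonneg _).trans this
  have hNY : 0 ≤ (∫ y : ℝ, ‖Y y‖ ^ 2) ^ (1 / 2 : ℝ) := by positivity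
  have hNW : 0 ≤ (∫ y : ℝ, ‖(((y - c : ℝ) : ℂ)) * Y y‖ ^ 2) ^ (1 / 2 : ℝ) := by positivity
  have hNL : 0 ≤ (∫ y : ℝ, ‖I * (G : ℂ) * ((2 / q : ℂ) * Y y
              - ∫ σ : ℝ, ((((2 * q - (y - σ) ^ 2) * (((y - σ) ^ 2 + q) ^ (5 / 2 : ℝ))⁻¹ : ℝ)) : ℂ) * Y σ)
            - ((w y : ℝ) : ℂ) * deriv Y y + β₁ y * Y y + β₂ y * conj (Y y)‖ ^ 2) ^ (1 / 2 : ℝ) := by positivity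
  have hNP : (∫ x : ℝ, ‖∫ y : ℝ, ((k (x - y) : ℝ) : ℂ) * Y y‖ ^ 2) ^ (1 / 2 : ℝ) ≤ (∫ t, |k t|) * (∫ y : ℝ, ‖Y y‖ ^ 2) ^ (1 / 2 : ℝ) := l2_le_of_sq_le hk0 hPle
  have hWP := l2_weight_piece_le hkc hki hk1 hYc hYs c
  have hP1le := integral_norm_piece_le hkc hki hYc hYs
  -- names for the real numbers
  set D : ℝ := ∫ x : ℝ, ‖∫ y : ℝ, ((k (x - y) : ℝ) : ℂ) * deriv Y y‖ ^ 2 with hD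
  set s : ℝ := (∫ x : ℝ, ‖∫ y : ℝ, ((k (x - y) : ℝ) : ℂ) * deriv Y y‖ ^ 2) ^ (1 / 2 : ℝ) with hs
  set X : ℝ := (∫ τ : ℝ, ‖((τ - c : ℝ) : ℂ) * ∫ y : ℝ, ((k (τ - y) : ℝ) : ℂ) * Y y‖ ^ 2) ^ (1 / 2 : ℝ) with hX
  set A : ℝ := (∫ τ : ℝ, ‖I * (G : ℂ) * ((2 / q : ℂ) * (∫ y : ℝ, ((k (τ - y) : ℝ) : ℂ) * Y y)
          - ∫ σ : ℝ, ((((2 * q - (τ - σ) ^ 2) * (((τ - σ) ^ 2 + q) ^ (5 / 2 : ℝ))⁻¹ : ℝ)) : ℂ) * ∫ y : ℝ, ((k (σ - y) : ℝ) : ℂ) * Y y)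
        - ((w τ : ℝ) : ℂ) * (∫ y : ℝ, ((k (τ - y) : ℝ) : ℂ) * deriv Y y) + β₁ τ * (∫ y : ℝ, ((k (τ - y) : ℝ) : ℂ) * Y y) + β₂ τ * conj (∫ y : ℝ, ((k (τ - y) : ℝ) : ℂ) * Y y)‖ ^ 2) ^ (1 / 2 : ℝ)
      * (∫ τ : ℝ, ‖∫ y : ℝ, ((k (τ - y) : ℝ) : ℂ) * Y y‖ ^ 2) ^ (1 / 2 : ℝ) with hA
  set B : ℝ := (b₁ + b₂) * ∫ τ : ℝ, ‖∫ y : ℝ, ((k (τ - y) : ℝ) : ℂ) * Y y‖ ^ 2 with hB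
  have hD0 : 0 ≤ D := integral_nonneg fun x => by positivity
  have hX0 : 0 ≤ X := by positivity
  have hs2 : s ^ 2 = D := by
    rw [hs, ← Real.sqrt_eq_rpow, Real.sq_sqrt hD0]
  -- Young: `Λ s X ≤ (g/2) s² + Λ²X²/(2g)`
  have hyoung : Λ * (s * X) ≤ (G * (1 / 2 * Real.log (1 / a))) / 2 * s ^ 2 + Λ ^ 2 * X ^ 2 / (2 * (G * (1 / 2 * Real.log (1 / a)))) := by
    rw [← sub_nonneg]
    have e : (G * (1 / 2 * Real.log (1 / a))) / 2 * s ^ 2 + Λ ^ 2 * X ^ 2 / (2 * (G * (1 / 2 * Real.log (1 / a)))) - Λ * (s * X)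
        = ((G * (1 / 2 * Real.log (1 / a))) * s - Λ * X) ^ 2 / (2 * (G * (1 / 2 * Real.log (1 / a)))) := by
      field_simp
      ring
    rw [e]; positivity
  -- `D ≤ (2/g)(A + B) + Λ²X²/g²`
  have h1 : (G * (1 / 2 * Real.log (1 / a))) / 2 * D ≤ A + B + Λ ^ 2 * X ^ 2 / (2 * (G * (1 / 2 * Real.log (1 / a)))) := by
    rw [hs2] at hyoung
    linarith [hdir, hyoung]
  have h2 : D ≤ 2 / (G * (1 / 2 * Real.log (1 / a))) * (A + B) + Λ ^ 2 / (G * (1 / 2 * Real.log (1 / a))) ^ 2 * X ^ 2 := by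
    have key : 2 / (G * (1 / 2 * Real.log (1 / a))) * ((G * (1 / 2 * Real.log (1 / a))) / 2 * D) = D := by field_simp
    calc D = 2 / (G * (1 / 2 * Real.log (1 / a))) * ((G * (1 / 2 * Real.log (1 / a))) / 2 * D) := key.symm
      _ ≤ 2 / (G * (1 / 2 * Real.log (1 / a))) * (A + B + Λ ^ 2 * X ^ 2 / (2 * (G * (1 / 2 * Real.log (1 / a))))) := mul_le_mul_of_nonneg_left h1 (by positivity)
      _ = 2 / (G * (1 / 2 * Real.log (1 / a))) * (A + B) + Λ ^ 2 / (G * (1 / 2 * Real.log (1 / a))) ^ 2 * X ^ 2 := by field_simp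
  -- bound `A`, `B`, `X²`
  have hA' : A ≤ (((∫ t, |k t|) * (∫ y : ℝ, ‖I * (G : ℂ) * ((2 / q : ℂ) * Y y
              - ∫ σ : ℝ, ((((2 * q - (y - σ) ^ 2) * (((y - σ) ^ 2 + q) ^ (5 / 2 : ℝ))⁻¹ : ℝ)) : ℂ) * Y σ)
            - ((w y : ℝ) : ℂ) * deriv Y y + β₁ y * Y y + β₂ y * conj (Y y)‖ ^ 2) ^ (1 / 2 : ℝ)
            + (Λ * ((∫ t, |t| * |k' t|) + (∫ t, |k t|)) + (L₁ + L₂) * (∫ t, |t| * |k t|)) * (∫ y : ℝ, ‖Y y‖ ^ 2) ^ (1 / 2 : ℝ)) * ((∫ t, |k t|) * (∫ y : ℝ, ‖Y y‖ ^ 2) ^ (1 / 2 : ℝ))) :=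
    mul_le_mul hL hNP (by positivity) (by positivity)
  have hB' : B ≤ ((b₁ + b₂) * ((∫ t, |k t|) ^ 2 * ∫ y : ℝ, ‖Y y‖ ^ 2)) := mul_le_mul_of_nonneg_left hPle hb0
  have hX2 : X ^ 2 ≤ 2 * ((∫ t, |k t|) * (∫ y : ℝ, ‖(((y - c : ℝ) : ℂ)) * Y y‖ ^ 2) ^ (1 / 2 : ℝ) + (∫ t, |t| * |k t|) * (∫ y : ℝ, ‖Y y‖ ^ 2) ^ (1 / 2 : ℝ)) ^ 2 := by
    have h := pow_le_pow_left₀ hX0 hWP 2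
    rw [mul_pow, Real.sq_sqrt (by norm_num)] at h
    exact h
  have h3 : 2 / (G * (1 / 2 * Real.log (1 / a))) * (A + B) + Λ ^ 2 / (G * (1 / 2 * Real.log (1 / a))) ^ 2 * X ^ 2
      ≤ 2 / (G * (1 / 2 * Real.log (1 / a))) * ((((∫ t, |k t|) * (∫ y : ℝ, ‖I * (G : ℂ) * ((2 / q : ℂ) * Y y
              - ∫ σ : ℝ, ((((2 * q - (y - σ) ^ 2) * (((y - σ) ^ 2 + q) ^ (5 / 2 : ℝ))⁻¹ : ℝ)) : ℂ) * Y σ)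
            - ((w y : ℝ) : ℂ) * deriv Y y + β₁ y * Y y + β₂ y * conj (Y y)‖ ^ 2) ^ (1 / 2 : ℝ)
            + (Λ * ((∫ t, |t| * |k' t|) + (∫ t, |k t|)) + (L₁ + L₂) * (∫ t, |t| * |k t|)) * (∫ y : ℝ, ‖Y y‖ ^ 2) ^ (1 / 2 : ℝ)) * ((∫ t, |k t|) * (∫ y : ℝ, ‖Y y‖ ^ 2) ^ (1 / 2 : ℝ)))
            + ((b₁ + b₂) * ((∫ t, |k t|) ^ 2 * ∫ y : ℝ, ‖Y y‖ ^ 2)))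
          + Λ ^ 2 / (G * (1 / 2 * Real.log (1 / a))) ^ 2 * (2 * ((∫ t, |k t|) * (∫ y : ℝ, ‖(((y - c : ℝ) : ℂ)) * Y y‖ ^ 2) ^ (1 / 2 : ℝ) + (∫ t, |t| * |k t|) * (∫ y : ℝ, ‖Y y‖ ^ 2) ^ (1 / 2 : ℝ)) ^ 2) :=
    add_le_add (mul_le_mul_of_nonneg_left (add_le_add hA' hB') (by positivity)) (mul_le_mul_of_nonneg_left hX2 (by positivity))
  have h5 : (∫ x : ℝ, ‖∫ y : ℝ, ((k (x - y) : ℝ) : ℂ) * Y y‖) ^ 2 ≤ ((∫ t, |k t|) * ∫ y : ℝ, ‖Y y‖) ^ 2 :=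
    pow_le_pow_left₀ (integral_nonneg fun x => norm_nonneg _) hP1le 2
  exact hbot.trans (add_le_add (mul_le_mul_of_nonneg_left h5 (by positivity)) (mul_le_mul_of_nonneg_left (h2.trans h3) (by positivity)))

end Summit.NavierStokesRegularity.NavierStokesRegularity.Theorems.MatchedKernel

end
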